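import Mathlib
import HarnessLib
import Summits.HubbardSuperconductivity.HubbardSuperconductivity.Theorems.KLProgrammeKLRegimeSplitGenericV3
import Summits.HubbardSuperconductivity.HubbardSuperconductivity.Theorems.KLProgrammeKLRegimeVolumeLimitDefs
import Summits.HubbardSuperconductivity.HubbardSuperconductivity.Theorems.KLProgrammeKLRegimeTwoPointAssemblyRepr
import Summits.HubbardSuperconductivity.HubbardSuperconductivity.Theorems.KLProgrammeKLRegimeTwoPointAssemblyDiag
import Summits.HubbardSuperconductivity.HubbardSuperconductivity.Theorems.KLProgrammeKLRegimeTwoPointAssemblyFree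
import Summits.HubbardSuperconductivity.HubbardSuperconductivity.Theorems.KLProgrammeKLRegimeTwoPointAssemblyInt
import Summits.HubbardSuperconductivity.HubbardSuperconductivity.Theorems.KLProgrammeKLRegimeTwoPointAssemblyFrame
import Summits.HubbardSuperconductivity.HubbardSuperconductivity.Theorems.KLProgrammeKLRegimeTwoPointAssemblyStubAsmMatsubara
import Summits.HubbardSuperconductivity.HubbardSuperconductivity.Theorems.KLProgrammeKLRegimeTwoPointAssemblyStubAsmPartition
import Literature.Probability.LatticeModels.TorusCentredLift

/-!
# Route `KLProgramme`, crux K3 — the TWO-POINT ASSEMBLY child `TwoPointAssemblyP3 Pr FinalTwoLegVolLimit W` for EVERY bundle `Pr` and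
# window `W`, in a ROUTE-FREE module (line `asm-repr`, lead hubbard-kl-r2d-p2)

This module carries the bundle-generic composition of the two-point assembly child (first landed inside the gen-2 closer
`…Theorems.KLProgrammeKLRegimeTwoPointAssemblyV7`, p456963) WITHOUT importing the route file `…Theses.KLProgramme`, so that the
by-name closers of the successive resplit generations (`KLRegimeTwoPointAssemblyV11_of`, `…V12_of`, …) import THIS module and the
route file only — the cell's standing build rule (only the leaf closer of a child imports a `Theses` file; every route edit
re-invalidates every importer).  The declarations live in the sub-namespace `…Theorems.TwoPointAssembly.Generic` and are stated in the forms the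
later generations need: the identities POINTWISE in the volume (`halfDelta_eq_of_abs_sub_lt`, `grassmannRatio_eq_reprFree_add_reprInt`
at every cutoff with a non-zero bare partition function), and the composition for EVERY volume-limit text `VL` that implies the
momentum-grid text `FinalTwoLegVolLimit` (`twoPointAssemblyP3_of_imp`; the child is antitone in its slot, `twoPointAssemblyP3_antitone`),
so that a strengthened slot of a later bundle (termwise / position-space) closes its assembly child by the same one-liner.  (The gen-2
closer keeps its `FinalTwoLegVolLimit`-only copies under `…Theorems.TwoPointAssembly`; Theorems files are append-only.)

Content (unchanged mathematics).  Child 4 reads only the volume-limit slot `VL = FinalTwoLegVolLimit` (p448970) and model identities;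
the tower `TowerP` is the volume-limit child's input, not ours.  Composition at fixed `(β, U, μ, K)`: for large `L`,
`T_L − ½δ_L = lim_M bareRatio_{L,M}` (`stub_asm_matsubara`, t2's all-`U` theorem); eventually in `M` the bare ratio is the
countertermed one (`stub_asm_frame`) which is `twoPointReprCT` (`stub_asm_repr`) `= reprFree + reprInt` (`stub_asm_diag`:
conservation + the pair function of `C^K`); `reprFree_{L,M} → fM L → F` (`stub_asm_free`: Matsubara tadpole + torus Riemann sums) and
`reprInt` is CAUCHY in the iterated sense (`stub_asm_int`, from `FinalTwoLegVolLimit`: grid convergence at each Matsubara integer +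
uniform bound `B` against `|ĝ_K|² ≤ ω⁻²`), so `lim_M reprInt_{L,M} = T_L − ½δ_L − fM L` exists and is Cauchy in `L`, hence converges
(`ℂ` complete).
-/

noncomputable section

namespace Summit.HubbardSuperconductivity.HubbardSuperconductivity.Theorems.TwoPointAssembly.Generic

set_option linter.dupNamespace false -- summit = problem name (single-conjunct summit), D-0017

open Real Finset Filter Topology Literature.MathematicalPhysics.QuantumLattice Literature.Probability.LatticeModels
open GrassmannAlgebra
open Summit.HubbardSuperconductivity.HubbardSuperconductivity.Theorems.KLRegimeSplit
open Summit.HubbardSuperconductivity.HubbardSuperconductivity.Theorems.KLProgrammeLegKernels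

/-- At a volume `L` beyond the coordinate differences of `x` and `y`, the finite-volume midpoint correction
`½[σ = σ'][x̄ = ȳ]` IS the infinite-volume one `halfDelta σ σ' x y` (pointwise form). -/
theorem halfDelta_eq_of_abs_sub_lt (σ σ' : Fin 2) {x y : Site 2} {L : ℕ} (hL : ∀ j, |x j - y j| < L) :
    (if σ = σ' ∧ Torus.proj L x = Torus.proj L y then (1 / 2 : ℂ) else 0) = halfDelta σ σ' x y := by
  rw [halfDelta]
  exact if_congr (Iff.and Iff.rfl ⟨fun h => Torus.proj_injective_of_abs_sub_lt hL h, fun h => by rw [h]⟩) rfl rfl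

/-- A natural number beyond every coordinate difference of two sites. -/
theorem exists_nat_forall_abs_sub_lt (x y : Site 2) : ∃ B : ℕ, ∀ j, |x j - y j| < (B : ℤ) := by
  refine ⟨(∑ j, |x j - y j|).toNat + 1, fun j => ?_⟩
  have h1 : |x j - y j| ≤ ∑ i, |x i - y i| := Finset.single_le_sum (fun i _ => abs_nonneg (x i - y i)) (Finset.mem_univ j)
  have h2 : (∑ i, |x i - y i|) ≤ ((∑ i, |x i - y i|).toNat : ℤ) := Int.self_le_toNat _
  push_cast
  linarith

/-- **The bare ratio IS the representation** `reprFree + reprInt` at every Matsubara cutoff `M` at which the bare Grassmann partition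
function is non-zero (pointwise form: frame change `stub_asm_frame` + source-shift representation `stub_asm_repr` + diagonal split
`stub_asm_diag`). -/
theorem grassmannRatio_eq_reprFree_add_reprInt (L M : ℕ) [NeZero L] [NeZero M] {β : ℝ} (hβ : 0 < β) (U μ : ℝ)
    (K : TrigPolyC4v) (σ σ' : Fin 2) (xe ye : TorusSite 2 L)
    (hZ : effPartitionFn ℂ (hubbardCovariance L M β μ 0) (hubbardInteraction L M β U) ≠ 0) :
    grassmannRatio L M β U μ σ σ' xe ye = reprFree L M β μ K σ σ' xe ye + reprInt L M β U μ K σ σ' xe ye := by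
  obtain ⟨N, hN, hframe⟩ := stub_asm_frame L M β hβ μ U K
  have hden : effPartitionFn ℂ (hubbardCovarianceCT L M β μ 0 K) (hubbardInteractionCT L M β U K) =
      N * effPartitionFn ℂ (hubbardCovariance L M β μ 0) (hubbardInteraction L M β U) := by
    rw [effPartitionFn_eq_gaussExpect, effPartitionFn_eq_gaussExpect, ← one_mul (grassmannExp _), hframe 1, one_mul]
  have hZK : effPartitionFn ℂ (hubbardCovarianceCT L M β μ 0 K) (hubbardInteractionCT L M β U K) ≠ 0 := by
    rw [hden]; exact mul_ne_zero hN hZ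
  have hrepr := stub_asm_repr L M β U μ K σ σ' xe ye hZK
  rw [← stub_asm_diag L M β hβ U μ K σ σ' xe ye, grassmannRatio]
  rw [hframe (twoPointInsertion L M β σ σ' xe ye), hden] at hrepr
  rw [div_eq_iff hZ]
  apply mul_left_cancel₀ hN
  rw [hrepr]; ring

/-- The two-point assembly child is ANTITONE in its volume-limit slot: a stronger volume-limit text (pointwise implication at
`β > 0`) gives the child for free from the child at the weaker text. -/
theorem twoPointAssemblyP3_antitone {Pr : Preds} {W : Set ℝ} {VL VL' : VolLimitSlot}
    (hVL : ∀ (β U μ : ℝ) (K : TrigPolyC4v) (Mstar : ℕ → ℕ), 0 < β → VL β U μ K Mstar → VL' β U μ K Mstar)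
    (h : TwoPointAssemblyP3 Pr VL' W) : TwoPointAssemblyP3 Pr VL W := by
  intro G P Q R hG hP hQ hR c hc
  obtain ⟨U₀, hU₀, hmain⟩ := h G P Q R hG hP hQ hR c hc
  refine ⟨U₀, hU₀, fun μ hμ U hU hUle β hβmin hβc Lstar Mstar hyp x y σ σ' => ?_⟩
  obtain ⟨K, hK, hT, hV⟩ := hyp
  exact hmain μ hμ U hU hUle β hβmin hβc Lstar Mstar ⟨K, hK, hT, hVL β U μ K Mstar (pos_of_klBetaMin_le hβmin) hV⟩ x y σ σ'

/-- **The two-point assembly child from the landed stubs, for every bundle `Pr`, window `W`, and EVERY volume-limit text `VL` that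
implies the momentum-grid text `FinalTwoLegVolLimit` at `β > 0`**: `TwoPointAssemblyP3 Pr VL W`.  The by-name closers of the resplit
generations are the instances `twoPointAssemblyP3_of_imp klPreds… klWindowC (fun _ _ _ _ _ _ h => h)`; a position-space or termwise
volume-limit text enters through its own implication lemma. -/
theorem twoPointAssemblyP3_of_imp (Pr : Preds) (W : Set ℝ) {VL : VolLimitSlot}
    (hVL : ∀ (β U μ : ℝ) (K : TrigPolyC4v) (Mstar : ℕ → ℕ), 0 < β → VL β U μ K Mstar → FinalTwoLegVolLimit β U μ K Mstar) :
    TwoPointAssemblyP3 Pr VL W := by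
  intro G P Q R _ _ _ _ c _
  refine ⟨1, one_pos, ?_⟩
  intro μ _ U _ _ β hβmin _ Lstar Mstar hyp x y σ σ'
  obtain ⟨K, _, _, hVLK⟩ := hyp
  have hβ : 0 < β := pos_of_klBetaMin_le hβmin
  obtain ⟨fM, F, hfM, hF⟩ := stub_asm_free β hβ μ K σ σ' x y
  have hint := stub_asm_int β hβ U μ K Mstar (hVL β U μ K Mstar hβ hVLK) σ σ' x y
  -- `u L = T_L − ½δ_L`, the `M`-limit of the bare ratio at `L ≥ 3`
  set u : ℕ → ℂ := fun L => hubbardThermalTwoPoint β U (μ + U / 2) L x y σ σ' -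
    (if σ = σ' ∧ Torus.proj L x = Torus.proj L y then (1 / 2 : ℂ) else 0) with hu
  -- `w L = u L − fM L`, the `M`-limit of the interacting part
  set w : ℕ → ℂ := fun L => u L - fM L with hw
  have hwlim : ∀ (L : ℕ) [NeZero L], 3 ≤ L →
      Tendsto (fun M : ℕ => reprInt L M β U μ K σ σ' (Torus.proj L x) (Torus.proj L y)) atTop (𝓝 (w L)) := by
    intro L _ hL
    have hmats := stub_asm_matsubara L hL β hβ μ U σ σ' x y
    have h1 : Tendsto (fun M : ℕ => grassmannRatio L M β U μ σ σ' (Torus.proj L x) (Torus.proj L y) -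
        reprFree L M β μ K σ σ' (Torus.proj L x) (Torus.proj L y)) atTop (𝓝 (u L - fM L)) := hmats.sub (hfM L hL)
    refine h1.congr' ?_
    filter_upwards [stub_asm_partition L hL β hβ μ U, eventually_ge_atTop 1] with M hZ hM
    haveI : NeZero M := ⟨by omega⟩
    rw [grassmannRatio_eq_reprFree_add_reprInt L M hβ U μ K σ σ' _ _ hZ]; ring
  -- `w` is Cauchy
  have hwC : CauchySeq fun n : ℕ => w (n + 3) := by
    rw [Metric.cauchySeq_iff]
    intro ε hε
    obtain ⟨L₁, hL₁⟩ := hint (ε / 2) (half_pos hε)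
    refine ⟨L₁, fun m hm n hn => ?_⟩
    haveI : NeZero (m + 3) := ⟨by omega⟩
    haveI : NeZero (n + 3) := ⟨by omega⟩
    obtain ⟨M₁, hM₁⟩ := hL₁ (m + 3) (n + 3) (by omega) (by omega)
    have hev : ∀ᶠ M : ℕ in atTop, ‖reprInt (m + 3) M β U μ K σ σ' (Torus.proj (m + 3) x) (Torus.proj (m + 3) y) -
        reprInt (n + 3) M β U μ K σ σ' (Torus.proj (n + 3) x) (Torus.proj (n + 3) y)‖ ≤ ε / 2 := by
      filter_upwards [eventually_ge_atTop (max M₁ 1)] with M hM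
      haveI : NeZero M := ⟨by have := le_of_max_le_right hM; omega⟩
      exact hM₁ M M (le_of_max_le_left hM) (le_of_max_le_left hM)
    have hlim := ((hwlim (m + 3) (by omega)).sub (hwlim (n + 3) (by omega))).norm
    have hle : ‖w (m + 3) - w (n + 3)‖ ≤ ε / 2 := le_of_tendsto hlim hev
    rw [dist_eq_norm]; linarith
  obtain ⟨Wlim, hW⟩ := cauchySeq_tendsto_of_complete hwC
  have hW' : Tendsto w atTop (𝓝 Wlim) := by
    rw [← tendsto_add_atTop_iff_nat 3]; exact hW
  -- assemble: `T_L = u L + ½δ_L = w L + fM L + ½δ_L` once `L` exceeds the coordinate differences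
  obtain ⟨B, hB⟩ := exists_nat_forall_abs_sub_lt x y
  refine ⟨Wlim + F + halfDelta σ σ' x y, ?_⟩
  have hsum : Tendsto (fun L => w L + fM L + halfDelta σ σ' x y) atTop (𝓝 (Wlim + F + halfDelta σ σ' x y)) :=
    (hW'.add hF).add tendsto_const_nhds
  refine hsum.congr' ?_
  filter_upwards [eventually_ge_atTop B] with L hL
  have hlt : ∀ j, |x j - y j| < (L : ℤ) := fun j => lt_of_lt_of_le (hB j) (by exact_mod_cast hL)
  simp only [hw, hu, halfDelta_eq_of_abs_sub_lt σ σ' hlt]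
  ring

end Summit.HubbardSuperconductivity.HubbardSuperconductivity.Theorems.TwoPointAssembly.Generic

end
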